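import Mathlib
import HarnessLib
import HarnessLib.Audit
import Summits.Langlands.Statement
import Summits.Langlands.Langlands.Theses.EllipticDegreeLadder
import HarnessLib.Audit.Status.Attr

/-!
Route: CMRestImageLocusSplit

# Route CMRestImageLocusSplit — «inside the CM-witness residual of GL₂ reciprocity, the open content
of the imaginary-quadratic case is NOT 'fields where X₀(15) has positive rank' (the host's reading
of Caraiani–Newton 2023 Thm 1.1) but 'witness CURVES whose residual images at the two switch primes
are both small': Caraiani–Newton's Theorem 7.1 is pointwise in E and needs no hypothesis on the
field, so every ρ whose imaginary-quadratic elliptic witness has irreducible E[5], or irreducible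
E[3] with image ≠ C_s⁺(3), is automorphic TODAY once the elliptic-sandwich transport is stated
pointwise; what is left is exactly the ρ all of whose integral IQ witnesses are K₀-points of the two
genus-one curves X(b3,b5) = X₀(15) = 15A1 and X(s3,b5) = 15A3 over a K₀ = ℚ(√−d) where
(kernel-certified) X₀(15)(K₀) is infinite — plus the CM-degree ≥ 4 residual.»  It suffices to show X
= GEN5 ∧ GEN3 ∧ LOC15 ∧ CMHIGH, where every cell is the host text of CMREST =
`EllipticDegreeLadder.CMWitnessRestAutomorphy` (stmt-Langlands-31036) VERBATIM with ONE conjunct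
appended to its hypothesis block «¬TR ∧ ¬FIN ∧ CM»; the appended dials are W5 = «some INTEGRAL
imaginary-quadratic witness E/𝓞_{K₀} with E_{K₀}[5] irreducible» (tree predicate
`WeierstrassCurve.HasIrreducibleModPGaloisRep 5`, the exact hypothesis of the tree fact
`CaraianiNewton2023_thm7_1_1`), W3 = «… with E_{K₀}[3] irreducible and mod-3 image not exactly
C_s⁺(3) = ⟨diag(1,2), antidiag(1,1)⟩ in any framing» (framing grammar byte-shared with
`SqrtFiveQuarticCovers.BoxBorelFive` 17835 / `QuinticX0105Split`), WIQ = «some integral IQ witness»: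
GEN5 = CMREST ∧ W5 (support, PRINT, closed at birth modulo the pointwise transport ETP + W⁺|₂ + R1:
`Theorems.CMRestImageLocusSplit.gen5_of_pieces`, kernel-checked); GEN3 = CMREST ∧ ¬W5 ∧ W3 (crux,
PRINT = CN Thm 7.1 (2), ATTACKABLE-NOW: `gen3_of_pieces`); LOC15 = CMREST ∧ ¬W5 ∧ ¬W3 ∧ WIQ (crux,
THE ATTACKED RESIDUAL: every integral IQ witness is a (b3 ∨ s3, b5)-curve over a rank-positive
ℚ(√−d) — `Cert.not_finite_X015_of_loc15`); CMHIGH = CMREST ∧ ¬WIQ (DECLARED RESIDUAL: CM witness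
degree ≥ 4).  Kernel (0 EQUIV, three nested excluded middles): `Cert.cmRest_iff_cells : CMREST ↔
GEN5 ∧ GEN3 ∧ LOC15 ∧ CMHIGH`.  New support ETP `EllipticTransportPointwise` = the host transport
TRANY 31038 VERBATIM except that the witness is an integral model and only ITS modularity is assumed
(TRANY needs every curve over 𝓞_{K₀} modular, which CN Thm 7.1 does not give).
Lean: IrreducibleFiveImQuadWitnessAutomorphy → IrreducibleThreeImQuadWitnessAutomorphy →
FifteenLocusImQuadWitnessAutomorphy → HigherCMDegreeWitnessAutomorphy →
Summit.Langlands.Langlands.Theses.EllipticDegreeLadder.CMWitnessRestAutomorphy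

REFINES route-Langlands-EllipticDegreeLadder:CMWitnessRestAutomorphy (edge split, depth 1; chain
route-Langlands-EllipticDegreeLadder › route-Langlands-CMRestImageLocusSplit) — the deciding theorem
of this CHILD route concludes the parent piece
`Summit.Langlands.Langlands.Theses.EllipticDegreeLadder.CMWitnessRestAutomorphy` BY NAME (imported
from Summits.Langlands.Langlands.Theses.EllipticDegreeLadder); closing this route proves that piece
of the parent, never the summit Statement (D-0170).

Rationale: WHY THIS LINE. CMREST (stmt-Langlands-31036, crux rank 203 of route-Langlands-EllipticDegreeLadder
rev 4, OPEN, never split, host docstring «ATTACKABLE / IDEA-NEEDED — the next rung») is the layer-2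
cell of the off-ladder rank-2 residual holding every twist-primitive ρ : Γ_K → GL₂(ℚ̄_ℓ) with a CM
elliptic sandwich witness but no totally-real one and no imaginary-quadratic one over a field with
X₀(15)(K₀) finite.  Its informal text reads the imaginary-quadratic part through Caraiani–Newton
2023 THEOREM 1.1 = Cor 7.1.2 [corpus:paper-arxiv-2301.10509 p2, p93] («F imaginary quadratic with
X₀(15)(F) finite ⇒ every E/F modular») and therefore files «X₀(15)(K₀) of positive rank» as
IDEA-NEEDED wholesale.  But the engine under Cor 7.1.2 is THEOREM 7.1 [ibid. p91]: «F imaginary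
quadratic, E/F with (1) E[5] irreducible, or (2) E[3] irreducible and image in Aut(E[3]) not the
normaliser of a split Cartan ⇒ E modular» — POINTWISE in E, with NO hypothesis on F; the finiteness
of X₀(15)(F) enters only to dispose of the exceptional level structures (b3,b5) and (s3,b5) left by
Lemma 7.1.1 (Dickson) [ibid. p92–93].  Lens 5 reads this literally: GENERIC/ASYMPTOTIC REGIME = big
residual image at 5 or at 3 (a theorem: clause (1) is the tree fact
`Literature.NumberTheory.Automorphic.CaraianiNewton2023_thm7_1_1`; clause (2) is in print, not yet
vendored); FINITE BASE RANGE = the finite list of exceptional image types at (3,5) — two level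
structures, i.e. the two genus-one curves 15A1, 15A3 (isogenous, rank 0 over ℚ); BRIDGE = Lemma
7.1.1's exhaustiveness + the elliptic-sandwich transport.  The one obstruction to running this
inside the host route is that its transport TRANY 31038 assumes the modularity of EVERY curve over
𝓞_{K₀}; the node therefore files the POINTWISE transport ETP (same print chain: Arthur–Clozel
solvable base change of π_E along L/K₀, ⊗ the Hecke character of χ via R1, a.e. Satake match via W⁺
+ Chebotarev + Jacquet–Shalika, solvable descent to K pinned by twist-primitivity — the chain only
ever used π_E) and takes the IQ witness through an INTEGRAL model so that CN's «E : WeierstrassCurve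
(𝓞 F), E.Δ ≠ 0» is met verbatim (Δ ≠ 0 from `IsElliptic` of the base change:
`delta_ne_zero_of_isElliptic_baseChange`).  Consequences, all kernel-checked in the node (0 sorry,
axioms propext/Classical.choice/Quot.sound): GEN5 is a theorem modulo ETP + W⁺|₂ + R1
(`gen5_of_pieces`, consuming the fact through its statement because its module is unbuilt on the
farm today); GEN3 likewise modulo the clause-(2) fact (`gen3_of_pieces`); the residual LOC15 is
reduced to its E-level content `FifteenLocusModularE` («(b3∨s3,b5)-curves over imaginary quadratic F
with X₀(15)(F) infinite are modular», `loc15_of_pieces`) and comes with the certificate that the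
witness field has X₀(15)(K₀) INFINITE (`Cert.not_finite_X015_of_loc15`: else E_{K₀} would be a
finite-X₀(15) witness, excluded by CMREST's own ¬FIN); CMHIGH is reduced to «all curves over CM
fields of degree ≠ 2 modular» + an integral-model lemma via the host TRANY by name
(`cmhigh_of_pieces`).  What the literature does not do: CN isolate the (b3∨s3,b5) locus only under
«X₀(15)(F) finite» (then it is 8 torsion points over ℚ(√−1), certified by Faltings–Serre, p93);
nobody states the locus over rank-positive ℚ(√−d) as the residual of GL₂ reciprocity for
twist-primitive ρ with an IQ elliptic witness, and the cell's only cut below OFF (lens-1-g8) grades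
witnesses by FIELD TYPE / X₀(15)-RANK, not by the witness curve's residual image.  Imported from
arithmetic geometry: Dickson's classification at 3 and 5, the moduli meaning of X₀(15), X(s3,b5)
(FLHS15 Lemmas 5.6–5.7 via CN p93), the rank-0/positive-rank dichotomy of 15A1 over ℚ(√−d) (root
number: d mod 15 ∈ {6,7,9,10,11,13,14} ⇒ odd rank, CN p2; first boxes ℚ(√−6), ℚ(√−7) — census AT16).
RANKED CRUXES. rank 2 LOC15 `FifteenLocusImQuadWitnessAutomorphy` (THE ATTACKED RESIDUAL ·
IDEA-NEEDED / INSTRUMENTABLE per (d, j): birth = the E-level statement split by «j rational»: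
`stub_locus15_rational_j` (BC5 PLAN-ONLY RUNG, print: CM or quadratic base change of a modular E₀/ℚ
+ twist — Wiles/BCDT + Langlands 1980; non-empty in every box via the four rational 15-isogeny
classes and their twists) and `stub_locus15_irrational_j` (the genuine residual: infinitely many j
per field); named levers — a residually-REDUCIBLE automorphy lifting theorem over CM fields at p ∈
{3,5} beyond the ordinary case of Allen–Khare–Thorne, a third switch prime (7: X(b3,b5,b7) =
X₀(105), X(s3,b5,b7) have genus 13, 21 and FINITELY many quadratic points — the IIY/Box move
transplanted to the CM side, where the lifting theorem at 7 over an imaginary quadratic field is the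
missing input), or per-curve Faltings–Serre–Livné certificates in the residually reducible case
[corpus:paper-arxiv-2510.12956 p3]); rank 3 GEN3 `IrreducibleThreeImQuadWitnessAutomorphy` (PRINT ·
ATTACKABLE-NOW: vendor CN Thm 7.1 (2) in the grammar of clause (1) — typing request D1 — then
`gen3_of_pieces`); rank 4 CMHIGH `HigherCMDegreeWitnessAutomorphy` (DECLARED RESIDUAL · IDEA-NEEDED:
modularity of elliptic curves over CM fields of degree ≥ 4; birth `stub_integral_model` +
`stub_cm_high` + TRANY); rank 9 supports GEN5 `IrreducibleFiveImQuadWitnessAutomorphy` (PRINT,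
closed at birth mod ETP/W⁺/R1) and ETP `EllipticTransportPointwise` (PRINT); rank 1 Assembly.
KILL CRITERIA. (i) A refuter shows CN Thm 7.1 (2)'s «image is not the normaliser of a split Cartan»
is NOT equivalent to «image not exactly ⟨diag(1,2), antidiag(1,1)⟩ in any framing» (it is, by Lemma
7.1.1: the irreducible proper subgroups of C_s⁺(3) ≅ D₄ are the cyclic C₄ ⊂ C_ns(3), covered by
clause (2) — a transposed framing convention is the only risk): GEN3 must be re-typed, the route
survives.  (ii) The tree's `HasIrreducibleModPGaloisRep` / `geomTorsion` turn out junk for base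
changes of integral models (bc7 CLEAN ×4 says no; a refuter's A1–A6 pass decides): re-type the dials
on field models + an explicit integral-model lemma.  (iii) `ledger`/`lean` shows CMREST closed or
split elsewhere by an image dial (dedup: attach).  (iv) A print theorem proving modularity of all
elliptic curves over all imaginary quadratic fields (LOC15 becomes print — the route is then happily
superseded at that cell; CMHIGH remains).  (v) A non-modular elliptic curve over some ℚ(√−d) on the
15-locus would refute LOC15 — and CMREST, OFF, R2 and `Langlands` with it (substantive, no repair).
NOT DECOMPOSED YET. LOC15 is NOT split into its two curves (15A1-points vs 15A3-points: isogenous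
curves, same rank, same difficulty — a split would be cosmetic) nor by d; the per-field instrument
(rank of 15A1 over ℚ(√−d), generators, the j-invariants of the resulting infinite families) is an
INSTRUMENT ask recorded in the informal text, not an item.  CMHIGH is not split by degree (that is
the host ladder's job on the TR side; on the CM side no degree is print).  GEN5/GEN3 are not split
(print).  DEPTH RULE proposed: descend below LOC15 only by (a) a lifting theorem covering a named
sub-locus (e.g. 5-ordinary (b3,b5)-curves via AKT-type results) or (b) a third-prime switch with a
finiteness certificate for the quadratic points of X(b3,b5,b7)/X(s3,b5,b7) over the relevant fields
— never by a further field-type dial (lens-1's axis) or by re-filing the E-level statement of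
`FifteenLocusEisenstein` (route-level sibling, cite only).
CHEAPEST FALSIFIER. Minutes, literature: CN Thm 7.1 must be stated for an ARBITRARY imaginary
quadratic F with no X₀(15) hypothesis — it is [corpus:paper-arxiv-2301.10509 p91: «Theorem 7.1. Let
F be an imaginary quadratic field, and let E/F be an elliptic curve such that one of the following
conditions holds: (1) … E[5] is irreducible … (2) … E[3] is irreducible and the image … is not the
normalizer of a split Cartan subgroup. Then E is modular.»] (checked this session); and Lemma 7.1.1
must leave exactly (b3,b5), (s3,b5) [p93: «we only need to consider E/F giving rise to an F-rational
point P of X₀(15) = X(b3,b5) or X(s3,b5)»] (checked).  Seconds, in Lean: kit probes (every cell ↛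
CMREST, every drop-one triple ↛ CMREST, no cell ↛ Langlands, no stub ↛ its cell: all expected
failures observed) and bc7 CLEAN.

Novelty: Searches RUN (2026-08-31, this seat; corpus fts+vec AND galaxy AND citation graph, labelled).  `lit
citing arxiv:2301.10509 --source api --since 2023` → 13 citers [graph:arxiv:2301.10509]: none
extends Thm 7.1 to the (b3∨s3,b5) locus or removes «X₀(15)(F) finite» from Thm 1.1 — nearest:
[corpus:paper-arxiv-2510.12956 p3] (Faltings–Serre–Livné–Grenié comparison in the residually
REDUCIBLE case: the per-curve certificate LOC15's instrument needs), [graph:arxiv:2503.17619] Smith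
2025 (BSD ⇒ Goldfeld: the density of d with rank X₀(15)(ℚ(√−d)) = 0, i.e. the MEASURE of CMFIN vs
LOC15, cf. CN p2 «Forthcoming work of Smith»), [corpus:paper-arxiv-2512.04641 p3–4] (automorphy
lifting for rank-2 unitary Shimura varieties, p ≥ 5, F_v = ℚ_{p²}: not the reducible p ∈ {3,5}
case), [graph:arxiv:2502.00141] (Bianchi forms, arbitrary class group: computational side).  `lit
search "modularity elliptic curves imaginary quadratic fields residually reducible" --year-from
2023` (local+crossref; openalex/s2 rate-limited) → local: the four above +
[corpus:paper-arxiv-2301.10509]; remote: Akers 2025 (deformation rings, residually reducible, IJNT),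
Zhang 2023 (cyclotomic ℤ_p-extensions), Thorne ECM survey 2023 — none on the 15-locus over imaginary
quadratic fields.  `lit vsearch "modularity of elliptic curves over an imaginary quadratic field
with rational 3-isogeny and 5-isogeny, points of X_0(15) over quadratic fields of positive rank"
--papers` → null (Dokchitser BSD-mod-squares, twist-rank papers o  [refs: 2301.10509, 2503.17619, 2502.00141, arxiv:2301.10509, paper-arxiv-2510.12956, arxiv:2503.17619, paper-arxiv-2512.04641, arxiv:2502.00141, paper-arxiv-2301.10509]

Barriers (technique_class: modularity-lifting-CM, image-switching, modular-curve-points): - technique_class: modularity-lifting-over-CM-fields (Calegari–Geraghty / 10-author /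
Caraiani–Newton local-global compatibility, Barsotti–Tate lifting), modularity-switching (3–5 at the
residual level, Dickson/Lemma 7.1.1), modular-curve-points (X₀(15), X(s3,b5) over quadratic fields),
elliptic-sandwich transport (solvable base change, Jacquet–Shalika, twist-primitivity descent)
- Literature.Barriers.Langlands.FamilyWitnessConsecutiveWeights: outside this route's technique
class; no item in scope.
- Literature.Barriers.Langlands.ResiduallyReducibleBarrier: GEN5 and GEN3 sit OUTSIDE — they are by
definition the big-image regime at the lifting prime (E[5] irreducible, resp. E[3] irreducible
non-C_s⁺(3)), exactly Caraiani–Newton's proved range [corpus:paper-arxiv-2301.10509 p91]; LOC15 sits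
INSIDE the barrier's locus at BOTH available primes by definition (ρ̄_{E,5} reducible and ρ̄_{E,3}
reducible or projectively dihedral-degenerate) — that is the point of the cut: the barrier's locus
is NAMED (two positive-rank genus-one curves' worth of witnesses) and never lifted here; its levers
either go around the barrier (a third prime 7 where the image is generically big again; per-curve
Faltings–Serre certificates, which compare two given representations and need no R = T) or must beat
it head-on (a reducible lifting theorem over CM fields beyond AKT's ordinary case) — LOC15 says
which, honestly, as IDEA-NEEDED; CMHIGH (residual) inherits the barrier exactly as the host's CMREST
did. ·

sub-problem: Langlands · status: draft · opened planner-decomp-langlands-writer-1-g7-0 2026-08-31T05:29:34Z · rev 2 · ledger route-Langlands-CMRestImageLocusSplit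
GENERATED by the gate from the ledger (D-0016/17). Provers cite these decls: `theorem foo : Summit.Langlands.Langlands.Theses.CMRestImageLocusSplit.<Decl> := …` in Summits/Langlands/Langlands/Theorems/<Name>.lean.
-/

namespace Summit.Langlands.Langlands.Theses.CMRestImageLocusSplit

open scoped BigOperators Topology Manifold Classical MeasureTheory ProbabilityTheory Matrix InnerProductSpace ComplexConjugate ContinuousMap
open Filter Set Function TopologicalSpace MeasureTheory

attribute [summit_statement] _root_.Langlands
attribute [summit_statement] _root_.Summit.Langlands.Langlands.Theses.EllipticDegreeLadder.CMWitnessRestAutomorphy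

/-- item stmt-Langlands-28038 · crux · leaf IDEA-NEEDED · rank 2 · open · by planner
why it might fail: As typed it wants EVERY (b3∨s3,b5)-curve over every rank-positive ℚ(√−d) modular: infinitely many j per field, reducible at 3 and 5 — no lifting theorem over CM fields applies (AKT: ordinary+irreducible), no finite enumeration; lever (b) needs lifting at 7 over IQ fields.
sources: corpus:paper-arxiv-2301.10509 p91 (Thm 7.1 (1),(2)), p92 (Lemma 7.1.1), p93 (Cor 7.1.2: X₀(15)=X(b3,b5)=15A1, X(s3,b5)=15A3, torsion over ℚ(√−1) via Faltings–Serre / LMFDB 4050.1-c3), p2 (Thm 1.1, rank-0 density, root numbers), corpus:paper-arxiv-2510.12956 p3 (Faltings–Serre–Livné–Grenié comparison, residually reducible case — the per-curve instrument), arXiv:1910.12986 (Allen–Khare–Thorne 2023, modularity over CM fields: residual hypotheses at 3, 5), FreitasLeHungSiksek2015 (arXiv:1310.7088: the (b3∨s3,b5) locus over real quadratic fields, 3–7 switch, X(b5,b7)/X(b3,b7)/X(s3,b7)), tree: EllipticDegreeLadder.CMWitnessRestAutomorphy (31036), ImQuadFiniteX0FifteenAutomorphy (31035), X0FifteenLegendre;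 census AT16 (first rank-positive d)
[crux · LOC15 · THE ATTACKED RESIDUAL · WEAKER-or-equal than CMREST 31036
(`Theorems.CMRestImageLocusSplit.Cert.loc15_of_cmRest`; no `LOC15 → CMREST`, `→ Langlands`, `→
GEN3/CMHIGH`: kit probes P3/P12, bc7c/g) · S-implied (`Cert.loc15_of_langlands`) · leaf IDEA-NEEDED
/ INSTRUMENTABLE per (d, j)] CMREST's text VERBATIM (K, ρ irreducible pinned-geometric
twist-primitive rank 2; ¬TR-witness ∧ ¬finite-X₀(15)-IQ-witness ∧ CM-witness ⇒ weakly automorphic)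
with ONE conjunct appended inside the hypothesis block: ¬W5 ∧ ¬W3 ∧ WIQ — ρ HAS an elliptic sandwich
witness over an imaginary quadratic K₀ given by an integral model E/𝓞_{K₀}, and EVERY such witness
has E_{K₀}[5] reducible and (E_{K₀}[3] reducible or mod-3 image exactly C_s⁺(3) = ⟨diag(1,2),
antidiag(1,1)⟩ in some framing): the witness is a K₀-point of X(b3,b5) = X₀(15) = 15A1 or of
X(s3,b5) = 15A3 (CN Cor 7.1.2, proof).  KERNEL-CERTIFIED SHARPENING
(`Cert.not_finite_X015_of_loc15`): CMREST's own ¬FIN forces X₀(15)(K₀) (Legendre model y² = x³ +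
41x² + 400x, = tree `X0FifteenLegendre`) to be INFINITE for every such witness field — so LOC15 is
exactly «(b3∨s3,b5)-curves over rank-positive ℚ(√−d)», the regime where the 3–5 switch does no -/
@[route_item "route-Langlands-CMRestImageLocusSplit", crux (bottleneck := idea) (source := "ledger D-0171 leaf tag IDEA-NEEDED on stmt-Langlands-28038, 2026-09-01")]
def FifteenLocusImQuadWitnessAutomorphy : Prop :=
  ∀ (K : Type) [Field K] [NumberField K] (hcpt : Literature.NumberTheory.Automorphic.isCompact_glFiniteIntegralLevel 2 K) (ℓ : ℕ) [Fact ℓ.Prime] (ι : PadicAlgCl ℓ ≃+* ℂ) (ρ : Literature.NumberTheory.GaloisRepresentations.FramedGaloisRep K (PadicAlgCl ℓ) 2), ρ.toGaloisRep.IsIrreducible → ((∀ᶠ v : IsDedekindDomain.HeightOneSpectrum (NumberField.RingOfIntegers K) in Filter.cofinite, ρ.IsUnramifiedAt v) ∧ ∀ (v : IsDedekindDomain.HeightOneSpectrum (NumberField.RingOfIntegers K)) (hv : ((ℓ : ℕ) : NumberField.RingOfIntegers K) ∈ v.asIdeal), (Literature.NumberTheory.PAdicHodge.fontainePstAdicCompletion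 v ℓ hv).IsDeRhamFramed (ρ.toLocal v)) → ¬ (∃ η : Literature.NumberTheory.GaloisRepresentations.FramedGaloisRep K (PadicAlgCl ℓ) 1, (∃ᶠ v : IsDedekindDomain.HeightOneSpectrum (NumberField.RingOfIntegers K) in Filter.cofinite, ∃ a : PadicAlgCl ℓ, a ≠ 1 ∧ η.HasFrobCharpolyAt v (Polynomial.X - Polynomial.C a)) ∧ ∀ᶠ v : IsDedekindDomain.HeightOneSpectrum (NumberField.RingOfIntegers K) in Filter.cofinite, ∃ (P : Polynomial (PadicAlgCl ℓ)) (a : PadicAlgCl ℓ), ρ.HasFrobCharpolyAt v P ∧ η.HasFrobCharpolyAt v (Polynomial.X - Polynomial.C a) ∧ P.scaleRoots a = P) → (¬ (∃ (L : Type) (_ : Field L) (_ : NumberField L) (_ : Algebra K L), IsGalois K L ∧ IsSolvable (L ≃ₐ[K] L) ∧ ∃ (K₀ : Type) (_ : Field K₀) (_ : NumberField K₀) (_ : Algebra K₀ L), IsGalois K₀ L ∧ IsSolvable (L ≃ₐ[K₀] L) ∧ NumberField.IsTotallyReal K₀ ∧ ∃ (E : WeierstrassCurve K₀) (_ : E.IsElliptic)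 (χ : Literature.NumberTheory.GaloisRepresentations.FramedGaloisRep L (PadicAlgCl ℓ) 1), ∀ g : Field.absoluteGaloisGroup L, Literature.NumberTheory.GaloisRepresentations.FramedRep.trace (ρ.restrictField L) g = Literature.NumberTheory.GaloisRepresentations.FramedRep.trace χ g * Literature.NumberTheory.GaloisRepresentations.FramedRep.trace ((E.framedTateGaloisRep ℓ).restrictField L) g) ∧ ¬ (∃ (L : Type) (_ : Field L) (_ : NumberField L) (_ : Algebra K L), IsGalois K L ∧ IsSolvable (L ≃ₐ[K] L) ∧ ∃ (K₀ : Type) (_ : Field K₀) (_ : NumberField K₀) (_ : Algebra K₀ L), IsGalois K₀ L ∧ IsSolvable (L ≃ₐ[K₀] L) ∧ NumberField.IsCMField K₀ ∧ Module.finrank ℚ K₀ = 2 ∧ Finite ((⟨0, 41, 0, 400, 0⟩ : WeierstrassCurve ℚ).baseChange K₀).toAffine.Point ∧ ∃ (E : WeierstrassCurve K₀) (_ : E.IsElliptic) (χ : Literature.NumberTheory.GaloisRepresentations.FramedGaloisRep L (PadicAlgCl ℓ) 1), ∀ g : Field.absoluteGaloisGroup L, Literature.NumberTheory.GaloisRepresentations.FramedRep.trace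 (ρ.restrictField L) g = Literature.NumberTheory.GaloisRepresentations.FramedRep.trace χ g * Literature.NumberTheory.GaloisRepresentations.FramedRep.trace ((E.framedTateGaloisRep ℓ).restrictField L) g) ∧ (∃ (L : Type) (_ : Field L) (_ : NumberField L) (_ : Algebra K L), IsGalois K L ∧ IsSolvable (L ≃ₐ[K] L) ∧ ∃ (K₀ : Type) (_ : Field K₀) (_ : NumberField K₀) (_ : Algebra K₀ L), IsGalois K₀ L ∧ IsSolvable (L ≃ₐ[K₀] L) ∧ NumberField.IsCMField K₀ ∧ ∃ (E : WeierstrassCurve K₀) (_ : E.IsElliptic) (χ : Literature.NumberTheory.GaloisRepresentations.FramedGaloisRep L (PadicAlgCl ℓ) 1), ∀ g : Field.absoluteGaloisGroup L, Literature.NumberTheory.GaloisRepresentations.FramedRep.trace (ρ.restrictField L) g = Literature.NumberTheory.GaloisRepresentations.FramedRep.trace χ g * Literature.NumberTheory.GaloisRepresentations.FramedRep.trace ((E.framedTateGaloisRep ℓ).restrictField L) g) ∧ ¬ (∃ (L : Type) (_ : Field L) (_ : NumberField L) (_ : Algebra K L), IsGalois K L ∧ IsSolvable (L ≃ₐ[K]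 L) ∧ ∃ (K₀ : Type) (_ : Field K₀) (_ : NumberField K₀) (_ : Algebra K₀ L), IsGalois K₀ L ∧ IsSolvable (L ≃ₐ[K₀] L) ∧ NumberField.IsCMField K₀ ∧ Module.finrank ℚ K₀ = 2 ∧ ∃ (E : WeierstrassCurve (NumberField.RingOfIntegers K₀)) (_ : (E.baseChange K₀).IsElliptic) (χ : Literature.NumberTheory.GaloisRepresentations.FramedGaloisRep L (PadicAlgCl ℓ) 1), (E.baseChange K₀).HasIrreducibleModPGaloisRep 5 ∧ ∀ g : Field.absoluteGaloisGroup L, Literature.NumberTheory.GaloisRepresentations.FramedRep.trace (ρ.restrictField L) g = Literature.NumberTheory.GaloisRepresentations.FramedRep.trace χ g * Literature.NumberTheory.GaloisRepresentations.FramedRep.trace (((E.baseChange K₀).framedTateGaloisRep ℓ).restrictField L) g) ∧ ¬ (∃ (L : Type) (_ : Field L) (_ : NumberField L) (_ : Algebra K L), IsGalois K L ∧ IsSolvable (L ≃ₐ[K] L) ∧ ∃ (K₀ : Type) (_ : Field K₀) (_ : NumberField K₀) (_ : Algebra K₀ L), IsGalois K₀ L ∧ IsSolvable (L ≃ₐ[K₀]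 L) ∧ NumberField.IsCMField K₀ ∧ Module.finrank ℚ K₀ = 2 ∧ ∃ (E : WeierstrassCurve (NumberField.RingOfIntegers K₀)) (_ : (E.baseChange K₀).IsElliptic) (χ : Literature.NumberTheory.GaloisRepresentations.FramedGaloisRep L (PadicAlgCl ℓ) 1), ((E.baseChange K₀).HasIrreducibleModPGaloisRep 3 ∧ ¬ (∃ ρ₃ : Literature.NumberTheory.GaloisRepresentations.FramedGaloisRep K₀ (ZMod 3) 2, (∃ e : (E.baseChange K₀).geomTorsion ((3 : ℕ) : ℤ) ≃+ (Fin 2 → ZMod 3), ∀ (σ : Field.absoluteGaloisGroup K₀) (P : (E.baseChange K₀).geomTorsion ((3 : ℕ) : ℤ)), e (σ • P) = ((ρ₃ σ : GL (Fin 2) (ZMod 3)) : Matrix (Fin 2) (Fin 2) (ZMod 3)) *ᵥ (e P)) ∧ (∀ σ : Field.absoluteGaloisGroup K₀, (ρ₃ σ : GL (Fin 2) (ZMod 3)) ∈ Subgroup.closure ({(⟨!![1, 0; 0, 2], !![1, 0; 0, 2], by decide, by decide⟩ : GL (Fin 2) (ZMod 3)), (⟨!![0, 1; 1, 0], !![0,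 1; 1, 0], by decide, by decide⟩ : GL (Fin 2) (ZMod 3))} : Set (GL (Fin 2) (ZMod 3)))) ∧ (∀ n ∈ Subgroup.closure ({(⟨!![1, 0; 0, 2], !![1, 0; 0, 2], by decide, by decide⟩ : GL (Fin 2) (ZMod 3)), (⟨!![0, 1; 1, 0], !![0, 1; 1, 0], by decide, by decide⟩ : GL (Fin 2) (ZMod 3))} : Set (GL (Fin 2) (ZMod 3))), ∃ σ : Field.absoluteGaloisGroup K₀, (ρ₃ σ : GL (Fin 2) (ZMod 3)) = n))) ∧ ∀ g : Field.absoluteGaloisGroup L, Literature.NumberTheory.GaloisRepresentations.FramedRep.trace (ρ.restrictField L) g = Literature.NumberTheory.GaloisRepresentations.FramedRep.trace χ g * Literature.NumberTheory.GaloisRepresentations.FramedRep.trace (((E.baseChange K₀).framedTateGaloisRep ℓ).restrictField L) g) ∧ (∃ (L : Type) (_ : Field L) (_ : NumberField L) (_ : Algebra K L), IsGalois K L ∧ IsSolvable (L ≃ₐ[K] L) ∧ ∃ (K₀ : Type) (_ : Field K₀) (_ : NumberField K₀) (_ : Algebra K₀ L), IsGalois K₀ L ∧ IsSolvable (L ≃ₐ[K₀]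 L) ∧ NumberField.IsCMField K₀ ∧ Module.finrank ℚ K₀ = 2 ∧ ∃ (E : WeierstrassCurve (NumberField.RingOfIntegers K₀)) (_ : (E.baseChange K₀).IsElliptic) (χ : Literature.NumberTheory.GaloisRepresentations.FramedGaloisRep L (PadicAlgCl ℓ) 1), ∀ g : Field.absoluteGaloisGroup L, Literature.NumberTheory.GaloisRepresentations.FramedRep.trace (ρ.restrictField L) g = Literature.NumberTheory.GaloisRepresentations.FramedRep.trace χ g * Literature.NumberTheory.GaloisRepresentations.FramedRep.trace (((E.baseChange K₀).framedTateGaloisRep ℓ).restrictField L) g)) → ∃ π : Literature.NumberTheory.Automorphic.CuspidalAutomorphicRepData 2 K hcpt, π.1.IsLAlgebraic ∧ ∀ᶠ v : IsDedekindDomain.HeightOneSpectrum (NumberField.RingOfIntegers K) in Filter.cofinite, SatakeFrobCompatibleAt ι π.1 ρ v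

/-- item stmt-Langlands-28039 · crux · leaf ATTACKABLE · rank 3 · open · by planner
why it might fail: Only formally: CN's «image not the normaliser of a split Cartan» must equal «not exactly ⟨diag(1,2),antidiag(1,1)⟩ in any framing» (Lemma 7.1.1 makes them agree); a transposed framing convention or junk `geomTorsion` for base-changed integral models would misstate it.
sources: corpus:paper-arxiv-2301.10509 p91 (Thm 7.1 (1),(2)), p92 (Lemma 7.1.1), p93 (Cor 7.1.2: X₀(15)=X(b3,b5)=15A1, X(s3,b5)=15A3, torsion over ℚ(√−1) via Faltings–Serre / LMFDB 4050.1-c3), p2 (Thm 1.1, rank-0 density, root numbers), tree: Literature/NumberTheory/Automorphic/CaraianiNewtonIrreducibleFive.lean (clause (1) only: CaraianiNewton2023_thm7_1_1 :110), Literature/NumberTheory/EllipticCurves/GaloisAction.lean (HasIrreducibleModPGaloisRep, geomTorsion), tree: SqrtFiveQuarticCovers.BoxBorelFive (17835) — framing grammar; QuinticX0105Split (C_s⁺(3) generators, −I = abab)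
[crux · GEN3 · PRINT · WEAKER-or-equal than CMREST (`Cert.gen3_of_cmRest`; no `GEN3 → CMREST` / `→
Langlands` / `→ GEN5`: probes P2/P11, bc7b/f) · S-implied (`Cert.gen3_of_langlands`) · leaf
ATTACKABLE-NOW (vendoring + `gen3_of_pieces`)] CMREST VERBATIM with ONE conjunct appended: ¬W5 ∧ W3
— no integral IQ witness has irreducible E[5], but SOME integral imaginary-quadratic witness
E/𝓞_{K₀} has E_{K₀}[3] IRREDUCIBLE with mod-3 image NOT EXACTLY C_s⁺(3) = ⟨diag(1,2), antidiag(1,1)⟩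
⊂ GL₂(𝔽₃) in any framing e : E[3](K̄₀) ≃ (ℤ/3)² (framing grammar byte-shared with
`SqrtFiveQuarticCovers.BoxBorelFive` 17835 and `QuinticX0105Split`).  IN PRINT: Caraiani–Newton 2023
Thm 7.1 (2) [corpus:paper-arxiv-2301.10509 p91] «the action of G_F on E[3] is irreducible and the
image of G_F in Aut(E[3]) is not the normalizer of a split Cartan subgroup ⇒ E modular» for EVERY
imaginary quadratic F; by Lemma 7.1.1 [p92] the irreducible proper subgroups of C_s⁺(3) ≅ D₄ are
cyclic C₄ ⊂ C_ns(3) and ARE covered by clause (2) (CN §7.2–7.5 treat X(ns3°,b5), X(b3,ns5),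
X(ns3°,ns5), X(s3,ns5)), so «not conjugate to C_s⁺(3)» = «not exactly N3 in any framing».  NOT YET
VENDORED: CaraianiNewtonIrreducibleFive.lean ren -/
@[route_item "route-Langlands-CMRestImageLocusSplit", crux (bottleneck := work) (source := "ledger D-0171 leaf tag ATTACKABLE on stmt-Langlands-28039, 2026-09-01")]
def IrreducibleThreeImQuadWitnessAutomorphy : Prop :=
  ∀ (K : Type) [Field K] [NumberField K] (hcpt : Literature.NumberTheory.Automorphic.isCompact_glFiniteIntegralLevel 2 K) (ℓ : ℕ) [Fact ℓ.Prime] (ι : PadicAlgCl ℓ ≃+* ℂ) (ρ : Literature.NumberTheory.GaloisRepresentations.FramedGaloisRep K (PadicAlgCl ℓ) 2), ρ.toGaloisRep.IsIrreducible → ((∀ᶠ v : IsDedekindDomain.HeightOneSpectrum (NumberField.RingOfIntegers K) in Filter.cofinite, ρ.IsUnramifiedAt v) ∧ ∀ (v : IsDedekindDomain.HeightOneSpectrum (NumberField.RingOfIntegers K)) (hv : ((ℓ : ℕ) : NumberField.RingOfIntegers K) ∈ v.asIdeal), (Literature.NumberTheory.PAdicHodge.fontainePstAdicCompletion v ℓ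 hv).IsDeRhamFramed (ρ.toLocal v)) → ¬ (∃ η : Literature.NumberTheory.GaloisRepresentations.FramedGaloisRep K (PadicAlgCl ℓ) 1, (∃ᶠ v : IsDedekindDomain.HeightOneSpectrum (NumberField.RingOfIntegers K) in Filter.cofinite, ∃ a : PadicAlgCl ℓ, a ≠ 1 ∧ η.HasFrobCharpolyAt v (Polynomial.X - Polynomial.C a)) ∧ ∀ᶠ v : IsDedekindDomain.HeightOneSpectrum (NumberField.RingOfIntegers K) in Filter.cofinite, ∃ (P : Polynomial (PadicAlgCl ℓ)) (a : PadicAlgCl ℓ), ρ.HasFrobCharpolyAt v P ∧ η.HasFrobCharpolyAt v (Polynomial.X - Polynomial.C a) ∧ P.scaleRoots a = P) → (¬ (∃ (L : Type) (_ : Field L) (_ : NumberField L) (_ : Algebra K L), IsGalois K L ∧ IsSolvable (L ≃ₐ[K] L) ∧ ∃ (K₀ : Type) (_ : Field K₀) (_ : NumberField K₀) (_ : Algebra K₀ L), IsGalois K₀ L ∧ IsSolvable (L ≃ₐ[K₀] L) ∧ NumberField.IsTotallyReal K₀ ∧ ∃ (E : WeierstrassCurve K₀) (_ : E.IsElliptic)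 (χ : Literature.NumberTheory.GaloisRepresentations.FramedGaloisRep L (PadicAlgCl ℓ) 1), ∀ g : Field.absoluteGaloisGroup L, Literature.NumberTheory.GaloisRepresentations.FramedRep.trace (ρ.restrictField L) g = Literature.NumberTheory.GaloisRepresentations.FramedRep.trace χ g * Literature.NumberTheory.GaloisRepresentations.FramedRep.trace ((E.framedTateGaloisRep ℓ).restrictField L) g) ∧ ¬ (∃ (L : Type) (_ : Field L) (_ : NumberField L) (_ : Algebra K L), IsGalois K L ∧ IsSolvable (L ≃ₐ[K] L) ∧ ∃ (K₀ : Type) (_ : Field K₀) (_ : NumberField K₀) (_ : Algebra K₀ L), IsGalois K₀ L ∧ IsSolvable (L ≃ₐ[K₀] L) ∧ NumberField.IsCMField K₀ ∧ Module.finrank ℚ K₀ = 2 ∧ Finite ((⟨0, 41, 0, 400, 0⟩ : WeierstrassCurve ℚ).baseChange K₀).toAffine.Point ∧ ∃ (E : WeierstrassCurve K₀) (_ : E.IsElliptic) (χ : Literature.NumberTheory.GaloisRepresentations.FramedGaloisRep L (PadicAlgCl ℓ) 1), ∀ g : Field.absoluteGaloisGroup L, Literature.NumberTheory.GaloisRepresentations.FramedRep.trace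 (ρ.restrictField L) g = Literature.NumberTheory.GaloisRepresentations.FramedRep.trace χ g * Literature.NumberTheory.GaloisRepresentations.FramedRep.trace ((E.framedTateGaloisRep ℓ).restrictField L) g) ∧ (∃ (L : Type) (_ : Field L) (_ : NumberField L) (_ : Algebra K L), IsGalois K L ∧ IsSolvable (L ≃ₐ[K] L) ∧ ∃ (K₀ : Type) (_ : Field K₀) (_ : NumberField K₀) (_ : Algebra K₀ L), IsGalois K₀ L ∧ IsSolvable (L ≃ₐ[K₀] L) ∧ NumberField.IsCMField K₀ ∧ ∃ (E : WeierstrassCurve K₀) (_ : E.IsElliptic) (χ : Literature.NumberTheory.GaloisRepresentations.FramedGaloisRep L (PadicAlgCl ℓ) 1), ∀ g : Field.absoluteGaloisGroup L, Literature.NumberTheory.GaloisRepresentations.FramedRep.trace (ρ.restrictField L) g = Literature.NumberTheory.GaloisRepresentations.FramedRep.trace χ g * Literature.NumberTheory.GaloisRepresentations.FramedRep.trace ((E.framedTateGaloisRep ℓ).restrictField L) g) ∧ ¬ (∃ (L : Type) (_ : Field L) (_ : NumberField L) (_ : Algebra K L), IsGalois K L ∧ IsSolvable (L ≃ₐ[K]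 L) ∧ ∃ (K₀ : Type) (_ : Field K₀) (_ : NumberField K₀) (_ : Algebra K₀ L), IsGalois K₀ L ∧ IsSolvable (L ≃ₐ[K₀] L) ∧ NumberField.IsCMField K₀ ∧ Module.finrank ℚ K₀ = 2 ∧ ∃ (E : WeierstrassCurve (NumberField.RingOfIntegers K₀)) (_ : (E.baseChange K₀).IsElliptic) (χ : Literature.NumberTheory.GaloisRepresentations.FramedGaloisRep L (PadicAlgCl ℓ) 1), (E.baseChange K₀).HasIrreducibleModPGaloisRep 5 ∧ ∀ g : Field.absoluteGaloisGroup L, Literature.NumberTheory.GaloisRepresentations.FramedRep.trace (ρ.restrictField L) g = Literature.NumberTheory.GaloisRepresentations.FramedRep.trace χ g * Literature.NumberTheory.GaloisRepresentations.FramedRep.trace (((E.baseChange K₀).framedTateGaloisRep ℓ).restrictField L) g) ∧ (∃ (L : Type) (_ : Field L) (_ : NumberField L) (_ : Algebra K L), IsGalois K L ∧ IsSolvable (L ≃ₐ[K] L) ∧ ∃ (K₀ : Type) (_ : Field K₀) (_ : NumberField K₀) (_ : Algebra K₀ L), IsGalois K₀ L ∧ IsSolvable (L ≃ₐ[K₀]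 L) ∧ NumberField.IsCMField K₀ ∧ Module.finrank ℚ K₀ = 2 ∧ ∃ (E : WeierstrassCurve (NumberField.RingOfIntegers K₀)) (_ : (E.baseChange K₀).IsElliptic) (χ : Literature.NumberTheory.GaloisRepresentations.FramedGaloisRep L (PadicAlgCl ℓ) 1), ((E.baseChange K₀).HasIrreducibleModPGaloisRep 3 ∧ ¬ (∃ ρ₃ : Literature.NumberTheory.GaloisRepresentations.FramedGaloisRep K₀ (ZMod 3) 2, (∃ e : (E.baseChange K₀).geomTorsion ((3 : ℕ) : ℤ) ≃+ (Fin 2 → ZMod 3), ∀ (σ : Field.absoluteGaloisGroup K₀) (P : (E.baseChange K₀).geomTorsion ((3 : ℕ) : ℤ)), e (σ • P) = ((ρ₃ σ : GL (Fin 2) (ZMod 3)) : Matrix (Fin 2) (Fin 2) (ZMod 3)) *ᵥ (e P)) ∧ (∀ σ : Field.absoluteGaloisGroup K₀, (ρ₃ σ : GL (Fin 2) (ZMod 3)) ∈ Subgroup.closure ({(⟨!![1, 0; 0, 2], !![1, 0; 0, 2], by decide, by decide⟩ : GL (Fin 2) (ZMod 3)), (⟨!![0, 1; 1, 0], !![0,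 1; 1, 0], by decide, by decide⟩ : GL (Fin 2) (ZMod 3))} : Set (GL (Fin 2) (ZMod 3)))) ∧ (∀ n ∈ Subgroup.closure ({(⟨!![1, 0; 0, 2], !![1, 0; 0, 2], by decide, by decide⟩ : GL (Fin 2) (ZMod 3)), (⟨!![0, 1; 1, 0], !![0, 1; 1, 0], by decide, by decide⟩ : GL (Fin 2) (ZMod 3))} : Set (GL (Fin 2) (ZMod 3))), ∃ σ : Field.absoluteGaloisGroup K₀, (ρ₃ σ : GL (Fin 2) (ZMod 3)) = n))) ∧ ∀ g : Field.absoluteGaloisGroup L, Literature.NumberTheory.GaloisRepresentations.FramedRep.trace (ρ.restrictField L) g = Literature.NumberTheory.GaloisRepresentations.FramedRep.trace χ g * Literature.NumberTheory.GaloisRepresentations.FramedRep.trace (((E.baseChange K₀).framedTateGaloisRep ℓ).restrictField L) g)) → ∃ π : Literature.NumberTheory.Automorphic.CuspidalAutomorphicRepData 2 K hcpt, π.1.IsLAlgebraic ∧ ∀ᶠ v : IsDedekindDomain.HeightOneSpectrum (NumberField.RingOfIntegers K) in Filter.cofinite, SatakeFrobCompatibleAt ι π.1 ρ v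

/-- item stmt-Langlands-28040 · crux · RESIDUAL (gen 0; summit-strength until shown otherwise, D-0170) · leaf IDEA-NEEDED · rank 4 · open · by planner
why it might fail: It is modularity of ALL elliptic curves over ALL CM fields of degree ≥ 4 (plus an integral-model lemma): only potential / positive-proportion / density-one results exist (BCGP, AKT, Whitmore, CN Thm 1.2); l₀ = 1 Taylor–Wiles defect throughout.
sources: corpus:paper-arxiv-2301.10509 p3 (state of the art over CM fields: ACC+18, BCGP21, AKT23, Whitmore; Rem 1.2.1), arXiv:1812.09999 (ACC+ 10-author: potential automorphy over CM fields), arXiv:1910.12986 (Allen–Khare–Thorne 2023), tree: EllipticDegreeLadder.EllipticTransportAnyBase (31038), SatakeAvatarExistence (17415), RankOneAutomorphy (24805)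
[residual · CMHIGH · DECLARED RESIDUAL of this node · WEAKER-or-equal than CMREST
(`Cert.cmhigh_of_cmRest`; no `CMHIGH → CMREST` / `→ Langlands` / `→ LOC15`: probes P4/P13, bc7d/h) ·
S-implied · leaf IDEA-NEEDED] CMREST VERBATIM with ONE conjunct appended: ¬WIQ — ρ has a CM elliptic
sandwich witness (CMREST) but NO witness over an imaginary quadratic K₀ given by an integral model.
On paper this is «every CM witness of ρ has degree [K₀:ℚ] ≥ 4» (a field-model IQ witness clears
denominators to an integral one: birth `stub_integral_model`, routine but a genuine Lean lemma on
`framedTateGaloisRep` under `VariableChange`); the Lean sliver {field IQ witness, no integral one}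
is empty on paper and harmless (it only makes CMHIGH weaker).  CONTENT: modularity of elliptic
curves over CM fields of degree ≥ 4 — potential modularity (ACC+18, BCGP21), a positive proportion
(AKT23, Whitmore 2022), Caraiani–Newton Thm 1.2 (density-one statements)
[corpus:paper-arxiv-2301.10509 p3]; open in general.  Closed from its E-level content by
`cmhigh_of_pieces : IntegralModelTransfer → HigherCMDegreeModularE → TRANY (host 31038 BY NAME) → W⁺
→ R1 → CMHIGH` (births `stub_integral_model`, `stub_cm_high`, `st -/
@[route_item "route-Langlands-CMRestImageLocusSplit", crux (bottleneck := idea) (source := "ledger wanted_by.residual on stmt-Langlands-28040, 2026-09-01")]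
def HigherCMDegreeWitnessAutomorphy : Prop :=
  ∀ (K : Type) [Field K] [NumberField K] (hcpt : Literature.NumberTheory.Automorphic.isCompact_glFiniteIntegralLevel 2 K) (ℓ : ℕ) [Fact ℓ.Prime] (ι : PadicAlgCl ℓ ≃+* ℂ) (ρ : Literature.NumberTheory.GaloisRepresentations.FramedGaloisRep K (PadicAlgCl ℓ) 2), ρ.toGaloisRep.IsIrreducible → ((∀ᶠ v : IsDedekindDomain.HeightOneSpectrum (NumberField.RingOfIntegers K) in Filter.cofinite, ρ.IsUnramifiedAt v) ∧ ∀ (v : IsDedekindDomain.HeightOneSpectrum (NumberField.RingOfIntegers K)) (hv : ((ℓ : ℕ) : NumberField.RingOfIntegers K) ∈ v.asIdeal), (Literature.NumberTheory.PAdicHodge.fontainePstAdicCompletion v ℓ hv).IsDeRhamFramed (ρ.toLocal v)) → ¬ (∃ η : Literature.NumberTheory.GaloisRepresentations.FramedGaloisRep K (PadicAlgCl ℓ) 1, (∃ᶠ v : IsDedekindDomain.HeightOneSpectrum (NumberField.RingOfIntegers K) in Filter.cofinite, ∃ a : PadicAlgCl ℓ, a ≠ 1 ∧ η.HasFrobCharpolyAt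 v (Polynomial.X - Polynomial.C a)) ∧ ∀ᶠ v : IsDedekindDomain.HeightOneSpectrum (NumberField.RingOfIntegers K) in Filter.cofinite, ∃ (P : Polynomial (PadicAlgCl ℓ)) (a : PadicAlgCl ℓ), ρ.HasFrobCharpolyAt v P ∧ η.HasFrobCharpolyAt v (Polynomial.X - Polynomial.C a) ∧ P.scaleRoots a = P) → (¬ (∃ (L : Type) (_ : Field L) (_ : NumberField L) (_ : Algebra K L), IsGalois K L ∧ IsSolvable (L ≃ₐ[K] L) ∧ ∃ (K₀ : Type) (_ : Field K₀) (_ : NumberField K₀) (_ : Algebra K₀ L), IsGalois K₀ L ∧ IsSolvable (L ≃ₐ[K₀] L) ∧ NumberField.IsTotallyReal K₀ ∧ ∃ (E : WeierstrassCurve K₀) (_ : E.IsElliptic) (χ : Literature.NumberTheory.GaloisRepresentations.FramedGaloisRep L (PadicAlgCl ℓ) 1), ∀ g : Field.absoluteGaloisGroup L, Literature.NumberTheory.GaloisRepresentations.FramedRep.trace (ρ.restrictField L) g = Literature.NumberTheory.GaloisRepresentations.FramedRep.trace χ g * Literature.NumberTheory.GaloisRepresentations.FramedRep.trace ((E.framedTateGaloisRep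 ℓ).restrictField L) g) ∧ ¬ (∃ (L : Type) (_ : Field L) (_ : NumberField L) (_ : Algebra K L), IsGalois K L ∧ IsSolvable (L ≃ₐ[K] L) ∧ ∃ (K₀ : Type) (_ : Field K₀) (_ : NumberField K₀) (_ : Algebra K₀ L), IsGalois K₀ L ∧ IsSolvable (L ≃ₐ[K₀] L) ∧ NumberField.IsCMField K₀ ∧ Module.finrank ℚ K₀ = 2 ∧ Finite ((⟨0, 41, 0, 400, 0⟩ : WeierstrassCurve ℚ).baseChange K₀).toAffine.Point ∧ ∃ (E : WeierstrassCurve K₀) (_ : E.IsElliptic) (χ : Literature.NumberTheory.GaloisRepresentations.FramedGaloisRep L (PadicAlgCl ℓ) 1), ∀ g : Field.absoluteGaloisGroup L, Literature.NumberTheory.GaloisRepresentations.FramedRep.trace (ρ.restrictField L) g = Literature.NumberTheory.GaloisRepresentations.FramedRep.trace χ g * Literature.NumberTheory.GaloisRepresentations.FramedRep.trace ((E.framedTateGaloisRep ℓ).restrictField L) g) ∧ (∃ (L : Type) (_ : Field L) (_ : NumberField L) (_ : Algebra K L), IsGalois K L ∧ IsSolvable (L ≃ₐ[K] L) ∧ ∃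 (K₀ : Type) (_ : Field K₀) (_ : NumberField K₀) (_ : Algebra K₀ L), IsGalois K₀ L ∧ IsSolvable (L ≃ₐ[K₀] L) ∧ NumberField.IsCMField K₀ ∧ ∃ (E : WeierstrassCurve K₀) (_ : E.IsElliptic) (χ : Literature.NumberTheory.GaloisRepresentations.FramedGaloisRep L (PadicAlgCl ℓ) 1), ∀ g : Field.absoluteGaloisGroup L, Literature.NumberTheory.GaloisRepresentations.FramedRep.trace (ρ.restrictField L) g = Literature.NumberTheory.GaloisRepresentations.FramedRep.trace χ g * Literature.NumberTheory.GaloisRepresentations.FramedRep.trace ((E.framedTateGaloisRep ℓ).restrictField L) g) ∧ ¬ (∃ (L : Type) (_ : Field L) (_ : NumberField L) (_ : Algebra K L), IsGalois K L ∧ IsSolvable (L ≃ₐ[K] L) ∧ ∃ (K₀ : Type) (_ : Field K₀) (_ : NumberField K₀) (_ : Algebra K₀ L), IsGalois K₀ L ∧ IsSolvable (L ≃ₐ[K₀] L) ∧ NumberField.IsCMField K₀ ∧ Module.finrank ℚ K₀ = 2 ∧ ∃ (E : WeierstrassCurve (NumberField.RingOfIntegers K₀)) (_ : (E.baseChange K₀).IsElliptic)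 (χ : Literature.NumberTheory.GaloisRepresentations.FramedGaloisRep L (PadicAlgCl ℓ) 1), ∀ g : Field.absoluteGaloisGroup L, Literature.NumberTheory.GaloisRepresentations.FramedRep.trace (ρ.restrictField L) g = Literature.NumberTheory.GaloisRepresentations.FramedRep.trace χ g * Literature.NumberTheory.GaloisRepresentations.FramedRep.trace (((E.baseChange K₀).framedTateGaloisRep ℓ).restrictField L) g)) → ∃ π : Literature.NumberTheory.Automorphic.CuspidalAutomorphicRepData 2 K hcpt, π.1.IsLAlgebraic ∧ ∀ᶠ v : IsDedekindDomain.HeightOneSpectrum (NumberField.RingOfIntegers K) in Filter.cofinite, SatakeFrobCompatibleAt ι π.1 ρ v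

/-- item stmt-Langlands-28041 · support · rank 9 · open · by planner
why it might fail: Closed modulo ETP/W⁺|₂/R1 and the fact's statement; fails only if `HasIrreducibleModPGaloisRep` is junk for base-changed integral models (bc7 CLEAN) or the fact's module never builds (then vendor clause (1) afresh).
sources: corpus:paper-arxiv-2301.10509 p91 (Thm 7.1 (1),(2)), p92 (Lemma 7.1.1), p93 (Cor 7.1.2: X₀(15)=X(b3,b5)=15A1, X(s3,b5)=15A3, torsion over ℚ(√−1) via Faltings–Serre / LMFDB 4050.1-c3), p2 (Thm 1.1, rank-0 density, root numbers), tree: Literature.NumberTheory.Automorphic.CaraianiNewton2023_thm7_1_1 (CaraianiNewtonIrreducibleFive.lean :110), FifteenLocusEisenstein.IrreducibleFiveModular (stmt-Langlands-16057)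
[support · GEN5 · PRINT · CLOSED AT BIRTH modulo ETP + W⁺|₂ + R1
(`Theorems.CMRestImageLocusSplit.gen5_of_pieces`, kernel-checked, 0 sorry) · WEAKER-or-equal than
CMREST (`Cert.gen5_of_cmRest`; no `GEN5 → CMREST` / `→ Langlands`: probes P1/P10, bc7a/e) · binder
of `closes`] CMREST VERBATIM with ONE conjunct appended: W5 — SOME elliptic sandwich witness of ρ
over an imaginary quadratic K₀ (NumberField.IsCMField K₀ ∧ finrank ℚ K₀ = 2) is given by an INTEGRAL
model E : WeierstrassCurve (𝓞 K₀) with (E.baseChange K₀).IsElliptic and (E.baseChange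
K₀).HasIrreducibleModPGaloisRep 5 (the tree predicate of
`Literature.NumberTheory.EllipticCurves.GaloisAction`), the sandwich running through ((E.baseChange
K₀).framedTateGaloisRep ℓ).  IN PRINT AND IN THE TREE: Caraiani–Newton 2023 Thm 7.1 (1)
[corpus:paper-arxiv-2301.10509 p91] =
`Literature.NumberTheory.Automorphic.CaraianiNewton2023_thm7_1_1 : ∀ F, IsTotallyComplex F → finrank
ℚ F = 2 → ∀ E : WeierstrassCurve (𝓞 F), E.Δ ≠ 0 → (E.baseChange F).HasIrreducibleModPGaloisRep 5 →
IsModularEllipticCurve F E` (CaraianiNewtonIrreducibleFive.lean :110; the module is not built on the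
farm today, so the node consumes the fact through its statement `Cara -/
@[route_item "route-Langlands-CMRestImageLocusSplit", crux]
def IrreducibleFiveImQuadWitnessAutomorphy : Prop :=
  ∀ (K : Type) [Field K] [NumberField K] (hcpt : Literature.NumberTheory.Automorphic.isCompact_glFiniteIntegralLevel 2 K) (ℓ : ℕ) [Fact ℓ.Prime] (ι : PadicAlgCl ℓ ≃+* ℂ) (ρ : Literature.NumberTheory.GaloisRepresentations.FramedGaloisRep K (PadicAlgCl ℓ) 2), ρ.toGaloisRep.IsIrreducible → ((∀ᶠ v : IsDedekindDomain.HeightOneSpectrum (NumberField.RingOfIntegers K) in Filter.cofinite, ρ.IsUnramifiedAt v) ∧ ∀ (v : IsDedekindDomain.HeightOneSpectrum (NumberField.RingOfIntegers K)) (hv : ((ℓ : ℕ) : NumberField.RingOfIntegers K) ∈ v.asIdeal), (Literature.NumberTheory.PAdicHodge.fontainePstAdicCompletion v ℓ hv).IsDeRhamFramed (ρ.toLocal v)) → ¬ (∃ η : Literature.NumberTheory.GaloisRepresentations.FramedGaloisRep K (PadicAlgCl ℓ) 1, (∃ᶠ v : IsDedekindDomain.HeightOneSpectrum (NumberField.RingOfIntegers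 K) in Filter.cofinite, ∃ a : PadicAlgCl ℓ, a ≠ 1 ∧ η.HasFrobCharpolyAt v (Polynomial.X - Polynomial.C a)) ∧ ∀ᶠ v : IsDedekindDomain.HeightOneSpectrum (NumberField.RingOfIntegers K) in Filter.cofinite, ∃ (P : Polynomial (PadicAlgCl ℓ)) (a : PadicAlgCl ℓ), ρ.HasFrobCharpolyAt v P ∧ η.HasFrobCharpolyAt v (Polynomial.X - Polynomial.C a) ∧ P.scaleRoots a = P) → (¬ (∃ (L : Type) (_ : Field L) (_ : NumberField L) (_ : Algebra K L), IsGalois K L ∧ IsSolvable (L ≃ₐ[K] L) ∧ ∃ (K₀ : Type) (_ : Field K₀) (_ : NumberField K₀) (_ : Algebra K₀ L), IsGalois K₀ L ∧ IsSolvable (L ≃ₐ[K₀] L) ∧ NumberField.IsTotallyReal K₀ ∧ ∃ (E : WeierstrassCurve K₀) (_ : E.IsElliptic) (χ : Literature.NumberTheory.GaloisRepresentations.FramedGaloisRep L (PadicAlgCl ℓ) 1), ∀ g : Field.absoluteGaloisGroup L, Literature.NumberTheory.GaloisRepresentations.FramedRep.trace (ρ.restrictField L) g = Literature.NumberTheory.GaloisRepresentations.FramedRep.trace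 χ g * Literature.NumberTheory.GaloisRepresentations.FramedRep.trace ((E.framedTateGaloisRep ℓ).restrictField L) g) ∧ ¬ (∃ (L : Type) (_ : Field L) (_ : NumberField L) (_ : Algebra K L), IsGalois K L ∧ IsSolvable (L ≃ₐ[K] L) ∧ ∃ (K₀ : Type) (_ : Field K₀) (_ : NumberField K₀) (_ : Algebra K₀ L), IsGalois K₀ L ∧ IsSolvable (L ≃ₐ[K₀] L) ∧ NumberField.IsCMField K₀ ∧ Module.finrank ℚ K₀ = 2 ∧ Finite ((⟨0, 41, 0, 400, 0⟩ : WeierstrassCurve ℚ).baseChange K₀).toAffine.Point ∧ ∃ (E : WeierstrassCurve K₀) (_ : E.IsElliptic) (χ : Literature.NumberTheory.GaloisRepresentations.FramedGaloisRep L (PadicAlgCl ℓ) 1), ∀ g : Field.absoluteGaloisGroup L, Literature.NumberTheory.GaloisRepresentations.FramedRep.trace (ρ.restrictField L) g = Literature.NumberTheory.GaloisRepresentations.FramedRep.trace χ g * Literature.NumberTheory.GaloisRepresentations.FramedRep.trace ((E.framedTateGaloisRep ℓ).restrictField L) g) ∧ (∃ (L : Type) (_ : Field L) (_ : NumberField L)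 (_ : Algebra K L), IsGalois K L ∧ IsSolvable (L ≃ₐ[K] L) ∧ ∃ (K₀ : Type) (_ : Field K₀) (_ : NumberField K₀) (_ : Algebra K₀ L), IsGalois K₀ L ∧ IsSolvable (L ≃ₐ[K₀] L) ∧ NumberField.IsCMField K₀ ∧ ∃ (E : WeierstrassCurve K₀) (_ : E.IsElliptic) (χ : Literature.NumberTheory.GaloisRepresentations.FramedGaloisRep L (PadicAlgCl ℓ) 1), ∀ g : Field.absoluteGaloisGroup L, Literature.NumberTheory.GaloisRepresentations.FramedRep.trace (ρ.restrictField L) g = Literature.NumberTheory.GaloisRepresentations.FramedRep.trace χ g * Literature.NumberTheory.GaloisRepresentations.FramedRep.trace ((E.framedTateGaloisRep ℓ).restrictField L) g) ∧ (∃ (L : Type) (_ : Field L) (_ : NumberField L) (_ : Algebra K L), IsGalois K L ∧ IsSolvable (L ≃ₐ[K] L) ∧ ∃ (K₀ : Type) (_ : Field K₀) (_ : NumberField K₀) (_ : Algebra K₀ L), IsGalois K₀ L ∧ IsSolvable (L ≃ₐ[K₀] L) ∧ NumberField.IsCMField K₀ ∧ Module.finrank ℚ K₀ = 2 ∧ ∃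 (E : WeierstrassCurve (NumberField.RingOfIntegers K₀)) (_ : (E.baseChange K₀).IsElliptic) (χ : Literature.NumberTheory.GaloisRepresentations.FramedGaloisRep L (PadicAlgCl ℓ) 1), (E.baseChange K₀).HasIrreducibleModPGaloisRep 5 ∧ ∀ g : Field.absoluteGaloisGroup L, Literature.NumberTheory.GaloisRepresentations.FramedRep.trace (ρ.restrictField L) g = Literature.NumberTheory.GaloisRepresentations.FramedRep.trace χ g * Literature.NumberTheory.GaloisRepresentations.FramedRep.trace (((E.baseChange K₀).framedTateGaloisRep ℓ).restrictField L) g)) → ∃ π : Literature.NumberTheory.Automorphic.CuspidalAutomorphicRepData 2 K hcpt, π.1.IsLAlgebraic ∧ ∀ᶠ v : IsDedekindDomain.HeightOneSpectrum (NumberField.RingOfIntegers K) in Filter.cofinite, SatakeFrobCompatibleAt ι π.1 ρ v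

/-- item stmt-Langlands-28042 · aside · rank 9 · open · by planner
why it might fail: Same single risk as TRANY 31038: solvable DESCENT from L to K for non-cyclic solvable layers needs the twist-primitivity pin at every cyclic step (Lapid–Rogawski); a solvable L/K with a non-descending intermediate twist would break the last arrow.
sources: ArthurClozel1989 (solvable base change for GL(n)), LapidRogawski1998 / Rajan2002 (descent for cyclic layers, multiplicity one up to twist), JacquetShalika1981 (strong multiplicity one), tree: EllipticDegreeLadder.EllipticTransportAnyBase (31038), EllipticTransport (27586-lineage), SatakeAvatarExistence (17415), RankOneAutomorphy (24805)
[support · ETP · PRINT · in-cone as `stub_transport` of the registered skeletons of GEN5/GEN3/LOC15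
· S-implied (`Cert.etp_of_langlands`) · no `ETP → CMREST` / `→ Langlands` / `→ any cell` (probes
P14, P20, BC3 rows)] The host transport TRANY = `EllipticDegreeLadder.EllipticTransportAnyBase`
(stmt-Langlands-31038) VERBATIM — same antecedents W⁺|₂ (17415 at n = 2) and R1 (24805,
`Cert.etp_antecedent_R1 : RankOneAutomorphy ↔ … := Iff.rfl`), same (K, ρ, L, K₀) binders of any
signature, same conclusion — EXCEPT the witness block: the witness is an INTEGRAL model `E :
WeierstrassCurve (𝓞 K₀)` with `(E.baseChange K₀).IsElliptic`, the sandwich runs through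
`((E.baseChange K₀).framedTateGaloisRep ℓ).restrictField L`, and only the modularity OF E ITSELF is
assumed (`(E.baseChange K₀).HasCM ∨ ∃ hF π, π.1.HasWeightZero ∧ a.e. Satake = frobTraceAt E`, =
`IsModularEllipticCurve K₀ E` by `Iff.rfl`) instead of TRANY's «∀ E' over 𝓞 K₀ with Δ ≠ 0, E'
modular».  WHY NEEDED: Caraiani–Newton Thm 7.1 is pointwise in E, TRANY is not usable with it.
PRINT CHAIN (identical to TRANY's, which only ever used π_E): E_{K₀} CM ⇒ ρ|Γ_L is an
induced/character sum, contradicting irreducibility-with-primitivity o -/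
@[route_item "route-Langlands-CMRestImageLocusSplit"]
def EllipticTransportPointwise : Prop :=
  (∀ (K : Type) [Field K] [NumberField K] (hcpt : Literature.NumberTheory.Automorphic.isCompact_glFiniteIntegralLevel 2 K) (π : Literature.NumberTheory.Automorphic.CuspidalAutomorphicRepData 2 K hcpt), π.1.IsLAlgebraic → ∀ (ℓ : ℕ) [Fact ℓ.Prime] (ι : PadicAlgCl ℓ ≃+* ℂ), ∃ ρ : Literature.NumberTheory.GaloisRepresentations.FramedGaloisRep K (PadicAlgCl ℓ) 2, ρ.toGaloisRep.IsIrreducible ∧ ∀ᶠ v : IsDedekindDomain.HeightOneSpectrum (NumberField.RingOfIntegers K) in Filter.cofinite, SatakeFrobCompatibleAt ι π.1 ρ v) → (∀ (K : Type) [Field K] [NumberField K] (hcpt : Literature.NumberTheory.Automorphic.isCompact_glFiniteIntegralLevel 1 K) (ℓ : ℕ) [Fact ℓ.Prime] (ι : PadicAlgCl ℓ ≃+* ℂ) (ρ : Literature.NumberTheory.GaloisRepresentations.FramedGaloisRep K (PadicAlgCl ℓ) 1), ρ.toGaloisRep.IsIrreducible → ((∀ᶠ v : IsDedekindDomain.HeightOneSpectrum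 (NumberField.RingOfIntegers K) in cofinite, ρ.IsUnramifiedAt v) ∧ ∀ (v : IsDedekindDomain.HeightOneSpectrum (NumberField.RingOfIntegers K)) (hv : ((ℓ : ℕ) : NumberField.RingOfIntegers K) ∈ v.asIdeal), (Literature.NumberTheory.PAdicHodge.fontainePstAdicCompletion v ℓ hv).IsDeRhamFramed (ρ.toLocal v)) → ∃ π : Literature.NumberTheory.Automorphic.CuspidalAutomorphicRepData 1 K hcpt, π.1.IsLAlgebraic ∧ ∀ᶠ v : IsDedekindDomain.HeightOneSpectrum (NumberField.RingOfIntegers K) in cofinite, SatakeFrobCompatibleAt ι π.1 ρ v) → ∀ (K : Type) [Field K] [NumberField K] (hcpt : Literature.NumberTheory.Automorphic.isCompact_glFiniteIntegralLevel 2 K) (ℓ : ℕ) [Fact ℓ.Prime] (ι : PadicAlgCl ℓ ≃+* ℂ) (ρ : Literature.NumberTheory.GaloisRepresentations.FramedGaloisRep K (PadicAlgCl ℓ) 2), ρ.toGaloisRep.IsIrreducible → ((∀ᶠ v : IsDedekindDomain.HeightOneSpectrum (NumberField.RingOfIntegers K) in Filter.cofinite, ρ.IsUnramifiedAt v) ∧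 ∀ (v : IsDedekindDomain.HeightOneSpectrum (NumberField.RingOfIntegers K)) (hv : ((ℓ : ℕ) : NumberField.RingOfIntegers K) ∈ v.asIdeal), (Literature.NumberTheory.PAdicHodge.fontainePstAdicCompletion v ℓ hv).IsDeRhamFramed (ρ.toLocal v)) → ¬ (∃ η : Literature.NumberTheory.GaloisRepresentations.FramedGaloisRep K (PadicAlgCl ℓ) 1, (∃ᶠ v : IsDedekindDomain.HeightOneSpectrum (NumberField.RingOfIntegers K) in Filter.cofinite, ∃ a : PadicAlgCl ℓ, a ≠ 1 ∧ η.HasFrobCharpolyAt v (Polynomial.X - Polynomial.C a)) ∧ ∀ᶠ v : IsDedekindDomain.HeightOneSpectrum (NumberField.RingOfIntegers K) in Filter.cofinite, ∃ (P : Polynomial (PadicAlgCl ℓ)) (a : PadicAlgCl ℓ), ρ.HasFrobCharpolyAt v P ∧ η.HasFrobCharpolyAt v (Polynomial.X - Polynomial.C a) ∧ P.scaleRoots a = P) → ∀ (L : Type) [Field L] [NumberField L] [Algebra K L], IsGalois K L → IsSolvable (L ≃ₐ[K] L) → ∀ (K₀ : Type) [Field K₀] [NumberField K₀] [Algebra K₀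 L], IsGalois K₀ L → IsSolvable (L ≃ₐ[K₀] L) → ∀ (E : WeierstrassCurve (NumberField.RingOfIntegers K₀)) [(E.baseChange K₀).IsElliptic] (χ : Literature.NumberTheory.GaloisRepresentations.FramedGaloisRep L (PadicAlgCl ℓ) 1), (∀ g : Field.absoluteGaloisGroup L, Literature.NumberTheory.GaloisRepresentations.FramedRep.trace (ρ.restrictField L) g = Literature.NumberTheory.GaloisRepresentations.FramedRep.trace χ g * Literature.NumberTheory.GaloisRepresentations.FramedRep.trace (((E.baseChange K₀).framedTateGaloisRep ℓ).restrictField L) g) → ((E.baseChange K₀).HasCM ∨ ∃ (hF : Literature.NumberTheory.Automorphic.isCompact_glFiniteIntegralLevel 2 K₀) (π : Literature.NumberTheory.Automorphic.CuspidalAutomorphicRepData 2 K₀ hF), π.1.HasWeightZero ∧ ∀ᶠ w : IsDedekindDomain.HeightOneSpectrum (NumberField.RingOfIntegers K₀) in Filter.cofinite, ∃ α : Multiset ℂ, π.1.HasSatakeParamAt w α ∧ ((Real.sqrt w.residueCard : ℝ) : ℂ) * α.sum = (Literature.NumberTheory.Automorphic.frobTraceAt E w : ℂ)) → ∃ π :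 Literature.NumberTheory.Automorphic.CuspidalAutomorphicRepData 2 K hcpt, π.1.IsLAlgebraic ∧ ∀ᶠ v : IsDedekindDomain.HeightOneSpectrum (NumberField.RingOfIntegers K) in Filter.cofinite, SatakeFrobCompatibleAt ι π.1 ρ v

/-- item stmt-Langlands-28048 · assembly · rank 1 · closed · proved by Summit.Langlands.Langlands.Theorems.cMRestImageLocusSplit_assembly_proof (prover) · by planner
[assembly · pure logic · = `Theorems.CMRestImageLocusSplit.closes` / `Cert.cmRest_of_cells`
verbatim] GEN5 → GEN3 → LOC15 → CMHIGH → CMREST (`EllipticDegreeLadder.CMWitnessRestAutomorphy`, the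
refined host crux BY NAME): given (K, ρ) in the CMREST box, by_cases on the three inlined dials — W5
(⇒ GEN5), else W3 (⇒ GEN3), else WIQ (⇒ LOC15), else CMHIGH; no predicate restated.  Through the
host: `Theorems.OffLadderRankTwoAutomorphy_of_split_proof` (HIGH → CMFIN → CMREST → DARK → TRANY →
OFF, landed) and `EllipticDegreeLadder.closes` (12 binders) → `Langlands`
(`Theorems.CMRestImageLocusSplit.closes_root`, axioms propext/Classical.choice/Quot.sound). -/
@[route_item "route-Langlands-CMRestImageLocusSplit"]
def Assembly : Prop :=
  IrreducibleFiveImQuadWitnessAutomorphy → IrreducibleThreeImQuadWitnessAutomorphy → FifteenLocusImQuadWitnessAutomorphy → HigherCMDegreeWitnessAutomorphy → Summit.Langlands.Langlands.Theses.EllipticDegreeLadder.CMWitnessRestAutomorphy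

-- `Assembly` holds: proved by `Summit.Langlands.Langlands.Theorems.cMRestImageLocusSplit_assembly_proof` (its module imports this route file, so no `_holds` link can be stated here).

/-! D-0027 §2.1 — DECIDING THEOREM (planner-authored via `route open/edit --closes-file`; by planner-decomp-langlands-writer-1-g7-0 2026-08-31T06:44:29Z):
its hypotheses are this route's items and its conclusion the registered leaf `Summit.Langlands.Langlands.Theses.EllipticDegreeLadder.CMWitnessRestAutomorphy` (rung None, D-0061) (glue_lint), and it elaborates with this file. -/

/-- DECIDING THEOREM of the child route `CMRestImageLocusSplit` (cell decomp-langlands, lens 5, gen 18; `refines`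
route-Langlands-EllipticDegreeLadder:CMWitnessRestAutomorphy, stmt-Langlands-31036): the four image-locus cells ⟹ the HOST
CRUX CMREST BY NAME (= node kernel `Summit.Langlands.Langlands.Theorems.CMRestImageLocusSplit.Cert.cmRest_of_cells`).  Pure logic; all four
binders are used: three nested excluded middles on the inlined dials W5 (integral IQ witness with irreducible E[5]), W3
(… irreducible E[3], image not exactly C_s⁺(3)), WIQ (integral IQ witness at all). -/
@[closes "route-Langlands-CMRestImageLocusSplit"] theorem closes (h5 : IrreducibleFiveImQuadWitnessAutomorphy) (h3 : IrreducibleThreeImQuadWitnessAutomorphy)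
    (hL : FifteenLocusImQuadWitnessAutomorphy) (hH : HigherCMDegreeWitnessAutomorphy) :
    Summit.Langlands.Langlands.Theses.EllipticDegreeLadder.CMWitnessRestAutomorphy := by
  intro K _ _ hcpt ℓ _ ι ρ hirr hgeo htw hbox
  by_cases hW5 : (∃ (L : Type) (_ : Field L) (_ : NumberField L) (_ : Algebra K L), IsGalois K L ∧ IsSolvable (L ≃ₐ[K] L) ∧ ∃ (K₀ : Type) (_ : Field K₀) (_ : NumberField K₀) (_ : Algebra K₀ L), IsGalois K₀ L ∧ IsSolvable (L ≃ₐ[K₀] L) ∧ NumberField.IsCMField K₀ ∧ Module.finrank ℚ K₀ = 2 ∧ ∃ (E : WeierstrassCurve (NumberField.RingOfIntegers K₀)) (_ : (E.baseChange K₀).IsElliptic) (χ : Literature.NumberTheory.GaloisRepresentations.FramedGaloisRep L (PadicAlgCl ℓ) 1), (E.baseChange K₀).HasIrreducibleModPGaloisRep 5 ∧ ∀ g : Field.absoluteGaloisGroup L, Literature.NumberTheory.GaloisRepresentations.FramedRep.trace (ρ.restrictField L) g = Literature.NumberTheory.GaloisRepresentations.FramedRep.trace χ g * Literature.NumberTheory.GaloisRepresentations.FramedRep.trace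 (((E.baseChange K₀).framedTateGaloisRep ℓ).restrictField L) g)
  · exact h5 K hcpt ℓ ι ρ hirr hgeo htw ⟨hbox.1, hbox.2.1, hbox.2.2, hW5⟩
  · by_cases hW3 : (∃ (L : Type) (_ : Field L) (_ : NumberField L) (_ : Algebra K L), IsGalois K L ∧ IsSolvable (L ≃ₐ[K] L) ∧ ∃ (K₀ : Type) (_ : Field K₀) (_ : NumberField K₀) (_ : Algebra K₀ L), IsGalois K₀ L ∧ IsSolvable (L ≃ₐ[K₀] L) ∧ NumberField.IsCMField K₀ ∧ Module.finrank ℚ K₀ = 2 ∧ ∃ (E : WeierstrassCurve (NumberField.RingOfIntegers K₀)) (_ : (E.baseChange K₀).IsElliptic) (χ : Literature.NumberTheory.GaloisRepresentations.FramedGaloisRep L (PadicAlgCl ℓ) 1), ((E.baseChange K₀).HasIrreducibleModPGaloisRep 3 ∧ ¬ (∃ ρ₃ : Literature.NumberTheory.GaloisRepresentations.FramedGaloisRep K₀ (ZMod 3) 2, (∃ e : (E.baseChange K₀).geomTorsion ((3 : ℕ) : ℤ) ≃+ (Fin 2 → ZMod 3), ∀ (σ : Field.absoluteGaloisGroup K₀)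 (P : (E.baseChange K₀).geomTorsion ((3 : ℕ) : ℤ)), e (σ • P) = ((ρ₃ σ : GL (Fin 2) (ZMod 3)) : Matrix (Fin 2) (Fin 2) (ZMod 3)) *ᵥ (e P)) ∧ (∀ σ : Field.absoluteGaloisGroup K₀, (ρ₃ σ : GL (Fin 2) (ZMod 3)) ∈ Subgroup.closure ({(⟨!![1, 0; 0, 2], !![1, 0; 0, 2], by decide, by decide⟩ : GL (Fin 2) (ZMod 3)), (⟨!![0, 1; 1, 0], !![0, 1; 1, 0], by decide, by decide⟩ : GL (Fin 2) (ZMod 3))} : Set (GL (Fin 2) (ZMod 3)))) ∧ (∀ n ∈ Subgroup.closure ({(⟨!![1, 0; 0, 2], !![1, 0; 0, 2], by decide, by decide⟩ : GL (Fin 2) (ZMod 3)), (⟨!![0, 1; 1, 0], !![0, 1; 1, 0], by decide, by decide⟩ : GL (Fin 2) (ZMod 3))} : Set (GL (Fin 2) (ZMod 3))), ∃ σ : Field.absoluteGaloisGroup K₀, (ρ₃ σ : GL (Fin 2) (ZMod 3)) = n))) ∧ ∀ g : Field.absoluteGaloisGroup L, Literature.NumberTheory.GaloisRepresentations.FramedRep.trace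 (ρ.restrictField L) g = Literature.NumberTheory.GaloisRepresentations.FramedRep.trace χ g * Literature.NumberTheory.GaloisRepresentations.FramedRep.trace (((E.baseChange K₀).framedTateGaloisRep ℓ).restrictField L) g)
    · exact h3 K hcpt ℓ ι ρ hirr hgeo htw ⟨hbox.1, hbox.2.1, hbox.2.2, hW5, hW3⟩
    · by_cases hWI : (∃ (L : Type) (_ : Field L) (_ : NumberField L) (_ : Algebra K L), IsGalois K L ∧ IsSolvable (L ≃ₐ[K] L) ∧ ∃ (K₀ : Type) (_ : Field K₀) (_ : NumberField K₀) (_ : Algebra K₀ L), IsGalois K₀ L ∧ IsSolvable (L ≃ₐ[K₀] L) ∧ NumberField.IsCMField K₀ ∧ Module.finrank ℚ K₀ = 2 ∧ ∃ (E : WeierstrassCurve (NumberField.RingOfIntegers K₀)) (_ : (E.baseChange K₀).IsElliptic) (χ : Literature.NumberTheory.GaloisRepresentations.FramedGaloisRep L (PadicAlgCl ℓ) 1), ∀ g : Field.absoluteGaloisGroup L, Literature.NumberTheory.GaloisRepresentations.FramedRep.trace (ρ.restrictField L) g = Literature.NumberTheory.GaloisRepresentations.FramedRep.trace χ g * Literature.NumberTheory.GaloisRepresentations.FramedRep.trace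 (((E.baseChange K₀).framedTateGaloisRep ℓ).restrictField L) g)
      · exact hL K hcpt ℓ ι ρ hirr hgeo htw ⟨hbox.1, hbox.2.1, hbox.2.2, hW5, hW3, hWI⟩
      · exact hH K hcpt ℓ ι ρ hirr hgeo htw ⟨hbox.1, hbox.2.1, hbox.2.2, hWI⟩

end Summit.Langlands.Langlands.Theses.CMRestImageLocusSplit
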